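import Summits.ResolutionOfSingularities.ResolutionOfSingularities.Theorems.HomologicalConductorNoZenoStageRational
import Summits.ResolutionOfSingularities.ResolutionOfSingularities.Theorems.HomologicalConductorNoZenoThreadStep
import Literature.AlgebraicGeometry.Resolution.NormalizationFractions
import HarnessLib

/-!
# Crux `NoZenoR` (stmt-ResolutionOfSingularities-19943) = `NoZeno` (stmt-16483), β2 descent line:
# RAT-STEP — a RATIONAL thread germ has RATIONAL successors (modulo Lipman's named fact (1.2) only)

OURS (cell res-hironaka, chain W4.4; stub worker res-L0-w44-stub-2 g11; object «RAT-STEP» of the consumer-side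
plan `L/res-L0-w44-stub-2/L1W-PREP.md` 4a61d05beab993ff §3.4 = STEP 4 of the proof route of the candidate stub
`stub_L1w` (planner res-L0-w44-plan-1 v24-draft r2.1 `Sig.L1`), and of EVERY instance of the measure-generic
descent: the slot `Sig.L1 𝓜 𝓢` concludes `HasRationalSingularity` of the NEXT thread germ whatever `𝓜` is).
Nothing here is a statement of the manuscript under review (Hironaka 2017); AI-written, weaker than expert review.

* `hasRationalSingularity_of_essFiniteType_of_injective` — **Lipman (1.2) 1) in abstract ring form, for an
  ESSENTIALLY-of-finite-type local extension inside the fraction field**: `R` a two-dimensional normal Noetherian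
  local domain with a rational singularity, `T` an `R`-algebra essentially of finite type mapping injectively into
  `K = Frac R` compatibly with `R`, `T` local normal of dimension two ⇒ `T` has a rational singularity.  (The
  finitely generated model `B₀ = EssFiniteType.subalgebra R T` has a common denominator; `T = (B₀)_𝔮`; then the
  tree's `hasRationalSingularity_of_isLocalization`.)  This is the pattern of `hasRationalSingularity_tower`
  (…NoZenoStageRational) with the regular base replaced by a rational one.
* `Thread.hasRationalSingularity_locPrime_of_le` — the same for two subrings `locPrime T P ≤ locPrime T' P'` of
  `K` (`T, T'` subalgebras over `k`, `Frac T = K`, `T'` essentially of finite type over `k`; e.g. `T' = nrm B` for a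
  blow-up chart `B` — the shape of the thread-free core `Sig.L1Core` of res-L0-w44-lead-1's `L1wCore.lean`).
* `Thread.hasRationalSingularity_locPrime_succ` — **RAT-STEP along a thread**: for compatible thread primes
  `P ⊆ T_m`, `P' ⊆ T_(m+1)`, if the germ `D_m = (T_m)_P` is a two-dimensional rational singularity and the next germ
  `D_(m+1) = (T_(m+1))_(P')` is two-dimensional, then `D_(m+1)` has a rational singularity.

References: J. Lipman, Publ. Math. IHÉS 36 (1969), Prop. (1.2) 1) (p. 199) [`Lipman1969`] — consumed ONLY through
the tree's named fact `Lipman1969_1_2` (hypothesis `h12`).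
-/

-- single-problem summit: the doubled namespace component `ResolutionOfSingularities` is forced
set_option linter.dupNamespace false

noncomputable section

namespace Summit.ResolutionOfSingularities.ResolutionOfSingularities.Theorems.NoZeno.SandwichCluster

open IsLocalRing
open Literature.AlgebraicGeometry.Resolution
open Summit.ResolutionOfSingularities.ResolutionOfSingularities.Theses.HomologicalConductor
open Summit.ResolutionOfSingularities.ResolutionOfSingularities.Theorems.NoZeno.Birth

universe u

/-! ## Lipman (1.2) 1) for essentially-of-finite-type local extensions inside the fraction field -/

/-- **A normal two-dimensional local ring essentially of finite type over a rational surface singularity, inside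
its fraction field, has a rational singularity** (Lipman, Prop. (1.2) 1), ring form): `R` a two-dimensional
normal Noetherian local domain with `HasRationalSingularity R`, `K = Frac R`, `T` an `R`-algebra essentially of
finite type with an injective ring map `φ : T → K` over `R`, `T` local, normal, of Krull dimension `2` ⇒
`HasRationalSingularity T`. [cite: Lipman1969, Proposition (1.2) 1) (p. 199)] -/
theorem hasRationalSingularity_of_essFiniteType_of_injective (h12 : Lipman1969_1_2.{u})
    {R T K : Type u} [CommRing R] [CommRing T] [Field K] [Algebra R T] [Algebra R K]
    [IsFractionRing R K] (φ : T →+* K) (hφ : Function.Injective φ)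
    (hcomm : ∀ r : R, φ (algebraMap R T r) = algebraMap R K r)
    [IsNoetherianRing R] [IsLocalRing R] [IsDomain R] [IsIntegrallyClosed R]
    (hdimR : ringKrullDim R = 2) (hR : HasRationalSingularity R)
    [IsLocalRing T] [IsDomain T] [IsIntegrallyClosed T] [Algebra.EssFiniteType R T]
    (hdimT : ringKrullDim T = 2) : HasRationalSingularity T := by
  classical
  -- the finitely generated model `B₀` and the prime `𝔮 = 𝔪_T ∩ B₀`
  set B₀ : Subalgebra R T := Algebra.EssFiniteType.subalgebra R T with hB₀
  let 𝔮 : Ideal ↥B₀ := (maximalIdeal T).comap (algebraMap ↥B₀ T)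
  haveI : 𝔮.IsPrime := Ideal.comap_isPrime _ _
  have hsub : Algebra.EssFiniteType.submonoid R T = 𝔮.primeCompl := by
    ext x
    simp only [Algebra.EssFiniteType.submonoid, Submonoid.mem_comap, IsUnit.mem_submonoid_iff,
      Ideal.primeCompl, 𝔮]
    change _ ↔ algebraMap (↥B₀) T x ∉ maximalIdeal T
    rw [IsLocalRing.mem_maximalIdeal, mem_nonunits_iff, not_not]
  haveI : IsLocalization.AtPrime T 𝔮 := by
    rw [IsLocalization.AtPrime, ← hsub]; infer_instance
  -- injectivity of `R → T` and `R → B₀`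
  have hRT : Function.Injective (algebraMap R T) := by
    intro a b h
    apply IsFractionRing.injective R K
    rw [← hcomm, ← hcomm, h]
  have hinj : Function.Injective (algebraMap R ↥B₀) := by
    intro a b h
    apply hRT
    have := congrArg (fun x : ↥B₀ => (x : T)) h
    exact this
  -- a denominator for each element of `T`
  have hden1 : ∀ t : T, ∃ d : R, d ≠ 0 ∧ ∃ a : R, algebraMap R T a = algebraMap R T d * t := by
    intro t
    obtain ⟨⟨a, d⟩, h⟩ := IsLocalization.surj (nonZeroDivisors R) (φ t)
    refine ⟨d, nonZeroDivisors.ne_zero d.2, a, hφ ?_⟩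
    rw [hcomm, map_mul, hcomm, ← h, mul_comm]
  choose d hd0 a ha using hden1
  -- the common denominator of the generators
  set s : Finset T := Algebra.EssFiniteType.finset R T with hs
  set r : R := ∏ t ∈ s, d t with hr
  have hr0 : r ≠ 0 := Finset.prod_ne_zero_iff.mpr fun t _ => hd0 t
  have hden : ∀ b ∈ Algebra.adjoin R (s : Set T), ∃ n : ℕ, ∃ c : R,
      algebraMap R T c = algebraMap R T r ^ n * b := by
    intro b hb
    induction hb using Algebra.adjoin_induction with
    | mem x hx =>
      refine ⟨1, a x * ∏ y ∈ s.erase x, d y, ?_⟩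
      rw [pow_one, hr, ← Finset.mul_prod_erase s d hx, map_mul, map_mul, ha x]
      ring
    | algebraMap c =>
      exact ⟨0, c, by rw [pow_zero, one_mul]⟩
    | add x y _ _ hx hy =>
      obtain ⟨n₁, a₁, h₁⟩ := hx
      obtain ⟨n₂, a₂, h₂⟩ := hy
      refine ⟨n₁ + n₂, r ^ n₂ * a₁ + r ^ n₁ * a₂, ?_⟩
      rw [map_add, map_mul, map_mul, map_pow, map_pow, h₁, h₂]
      ring
    | mul x y _ _ hx hy =>
      obtain ⟨n₁, a₁, h₁⟩ := hx
      obtain ⟨n₂, a₂, h₂⟩ := hy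
      refine ⟨n₁ + n₂, a₁ * a₂, ?_⟩
      rw [map_mul, h₁, h₂]
      ring
  have hB : ∀ b : ↥B₀, ∃ n : ℕ, ∃ c : R,
      algebraMap R ↥B₀ c = algebraMap R ↥B₀ r ^ n * b := by
    rintro ⟨b, hb⟩
    obtain ⟨n, c, hc⟩ := hden b hb
    refine ⟨n, c, Subtype.ext ?_⟩
    simpa using hc
  exact hasRationalSingularity_of_isLocalization h12 hdimR hR hinj r hr0 hB 𝔮 (T := T) hdimT

namespace Thread

variable {k K : Type} [Field k] [Field K] [Algebra k K]

/-- **Lipman (1.2) 1) between two prime localisations of stages**: `T, T'` subalgebras of `K` over `k` with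
`Frac T = K` and `T'` essentially of finite type over `k`; `P ⊆ T`, `P' ⊆ T'` primes with
`locPrime T P ≤ locPrime T' P'` (as subrings of `K`); if `(T)_P` is a two-dimensional normal Noetherian rational
singularity and `(T')_(P')` is normal of dimension two, then `(T')_(P')` has a rational singularity.  (For the
thread-free core `Sig.L1Core` of the β2 descent: `T' := nrm B`, `B` the blow-up chart `k[(T)_P ∪ C·x⁻¹]`.)
[cite: Lipman1969, Proposition (1.2) 1) (p. 199)] -/
theorem hasRationalSingularity_locPrime_of_le (h12 : Lipman1969_1_2.{0}) (T T' : Subalgebra k K)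
    [IsFractionRing ↥T K] [Algebra.EssFiniteType k ↥T']
    (P : Ideal ↥T) (hP : P.IsPrime) (P' : Ideal ↥T') (hP' : P'.IsPrime)
    (hle : Parasite.locPrime T P hP ≤ Parasite.locPrime T' P' hP')
    (hN : IsNoetherianRing ↥(Parasite.locPrime T P hP))
    (hIC : IsIntegrallyClosed ↥(Parasite.locPrime T P hP))
    (hdim : ringKrullDim ↥(Parasite.locPrime T P hP) = 2)
    (hrat : HasRationalSingularity ↥(Parasite.locPrime T P hP))
    (hIC' : IsIntegrallyClosed ↥(Parasite.locPrime T' P' hP'))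
    (hdim' : ringKrullDim ↥(Parasite.locPrime T' P' hP') = 2) :
    HasRationalSingularity ↥(Parasite.locPrime T' P' hP') := by
  haveI := hP
  haveI := hP'
  haveI := hN
  haveI := hIC
  haveI := hIC'
  set D := Parasite.locPrime T P hP with hD
  set D' := Parasite.locPrime T' P' hP' with hD'
  haveI : IsLocalRing ↥D := Parasite.isLocalRing_locPrime _ _ _
  haveI : IsLocalRing ↥D' := Parasite.isLocalRing_locPrime _ _ _
  -- `D` as an affine model: `Frac D = K`
  letI algDK : Algebra ↥D K := D.subtype.toAlgebra
  haveI : IsFractionRing ↥D K := by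
    refine isFractionRing_of_forall_exists_div D fun z => ?_
    obtain ⟨x, y, -, rfl⟩ := IsFractionRing.div_surjective (A := ↥T) z
    exact ⟨(x : K), toSubring_le_locPrime T P hP x.2, (y : K), toSubring_le_locPrime T P hP y.2, rfl⟩
  -- `D'` as a `D`-algebra, essentially of finite type (it is so over `k ⊆ D`)
  letI algDD' : Algebra ↥D ↥D' := (Subring.inclusion hle).toAlgebra
  letI algTD' : Algebra ↥T' ↥D' := (Subring.inclusion (toSubring_le_locPrime T' P' hP')).toAlgebra
  haveI := isLocalization_locPrime T' P' hP'
  letI algkD' : Algebra k ↥D' := ((algebraMap ↥T' ↥D').comp (algebraMap k ↥T')).toAlgebra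
  haveI : IsScalarTower k ↥T' ↥D' := IsScalarTower.of_algebraMap_eq fun _ => rfl
  haveI : Algebra.EssFiniteType ↥T' ↥D' := Algebra.EssFiniteType.of_isLocalization _ P'.primeCompl
  haveI : Algebra.EssFiniteType k ↥D' := Algebra.EssFiniteType.comp k ↥T' _
  -- the `k`-structure on `D'` factors through `D`: both send `c : k` to `algebraMap k K c`
  letI algkD₀ : Algebra k ↥D :=
    (RingHom.codRestrict (algebraMap k K) D fun c => toSubring_le_locPrime T P hP (algebraMap k ↥T c).2).toAlgebra
  haveI : IsScalarTower k ↥D ↥D' := IsScalarTower.of_algebraMap_eq fun c => Subtype.ext rfl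
  haveI : Algebra.EssFiniteType ↥D ↥D' := Algebra.EssFiniteType.of_comp k ↥D ↥D'
  refine hasRationalSingularity_of_essFiniteType_of_injective h12 (R := ↥D) (T := ↥D') (K := K)
    D'.subtype (Subring.subtype_injective D') (fun _ => rfl) hdim hrat hdim'

/-- **RAT-STEP along a thread** (modulo Lipman (1.2)): for a compatible pair of thread primes `P ⊆ T_(n+1)`,
`P' ⊆ T_(n+2)` (an element of `T_(n+1)` lying in `P'` lies in `P`), if the germ `D_(n+1) = (T_(n+1))_P` is
two-dimensional with a rational singularity and the next germ `D_(n+2) = (T_(n+2))_(P')` is two-dimensional, then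
`D_(n+2)` has a rational singularity.  (`D_(n+1) ≤ D_(n+2)` by `locPrime_le_locPrime_succ`; both are normal
Noetherian local rings — prime localisations of the normal stages; `hasRationalSingularity_locPrime_of_le`.)
This is STEP 4 of the consumer plan for `stub_L1w` and the `HasRationalSingularity` conjunct of EVERY instance of the
β2 descent slot `Sig.L1`. [cite: Lipman1969, Proposition (1.2) 1) (p. 199)] -/
theorem hasRationalSingularity_locPrime_succ (h12 : Lipman1969_1_2.{0}) (O : ValuationSubring K)
    (A : Subalgebra k K) (hk : ∀ c : k, algebraMap k K c ∈ O) (hA : A.FG) (hfr : IsFractionRing ↥A K)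
    (hAO : A.toSubring ≤ O.toSubring) (n : ℕ)
    (P : Ideal ↥(tower O A (n + 1))) (hP : P.IsPrime)
    (P' : Ideal ↥(tower O A (n + 1 + 1))) (hP' : P'.IsPrime)
    (hcompat : ∀ (x : K) (hx : x ∈ tower O A (n + 1)) (hx' : x ∈ tower O A (n + 1 + 1)),
      (⟨x, hx'⟩ : ↥(tower O A (n + 1 + 1))) ∈ P' → (⟨x, hx⟩ : ↥(tower O A (n + 1))) ∈ P)
    (hdim : ringKrullDim ↥(Parasite.locPrime (tower O A (n + 1)) P hP) = 2)
    (hrat : HasRationalSingularity ↥(Parasite.locPrime (tower O A (n + 1)) P hP))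
    (hdim' : ringKrullDim ↥(Parasite.locPrime (tower O A (n + 1 + 1)) P' hP') = 2) :
    HasRationalSingularity ↥(Parasite.locPrime (tower O A (n + 1 + 1)) P' hP') := by
  haveI := hfr
  haveI := hP
  haveI := hP'
  -- the stages: Noetherian, normal, essentially of finite type, affine models of `K`
  haveI : IsNoetherianRing ↥(tower O A (n + 1)) := stub_towerNoetherian k K O A hk hA hfr hAO (n + 1)
  haveI : IsIntegrallyClosed ↥(tower O A (n + 1)) := d2rc_isIntegrallyClosed_tower_succ O A hk hA hfr hAO n
  haveI : IsIntegrallyClosed ↥(tower O A (n + 1 + 1)) :=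
    d2rc_isIntegrallyClosed_tower_succ O A hk hA hfr hAO (n + 1)
  haveI : IsFractionRing ↥(tower O A (n + 1)) K :=
    Literature.AlgebraicGeometry.Resolution.isFractionRing_subalgebra_of_le A _
      (tn_tower_invariant O A hk hA hfr hAO (n + 1)).1
  haveI : Algebra.EssFiniteType k ↥(tower O A (n + 1 + 1)) := (tn_tower_invariant O A hk hA hfr hAO (n + 1 + 1)).2.2
  -- the germs: Noetherian (localisations) and normal
  have hN : IsNoetherianRing ↥(Parasite.locPrime (tower O A (n + 1)) P hP) := by
    letI : Algebra ↥(tower O A (n + 1)) ↥(Parasite.locPrime (tower O A (n + 1)) P hP) :=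
      (Subring.inclusion (toSubring_le_locPrime (tower O A (n + 1)) P hP)).toAlgebra
    haveI := isLocalization_locPrime (tower O A (n + 1)) P hP
    exact IsLocalization.isNoetherianRing P.primeCompl _ inferInstance
  exact hasRationalSingularity_locPrime_of_le h12 (tower O A (n + 1)) (tower O A (n + 1 + 1)) P hP P' hP'
    (locPrime_le_locPrime_succ O A (n + 1) P hP P' hP' hcompat) hN
    (isIntegrallyClosed_locPrime (tower O A (n + 1)) P hP) hdim hrat
    (isIntegrallyClosed_locPrime (tower O A (n + 1 + 1)) P' hP') hdim'

end Thread

end Summit.ResolutionOfSingularities.ResolutionOfSingularities.Theorems.NoZeno.SandwichCluster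

end
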